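import Summits.AtomisticToContinuum.Crystallization.Theorems.ChartedZeroExcessLayeredLatticeLiouvilleZZZYO

/-!
# ChartedZeroExcess · LayeredLatticeLiouville ZZZYPA (lens-2 g96 NODE 96c «RimPin») — the interface pin propagates through the tube

Docket `stmt-AtomisticToContinuum-26636`, W2 line; residual of record «W2o» (door `mildCoherentMoatCorePG_W2o`, tree ZZZYO).  The inner tube
`bondTube X Rg sb₁ dI₁ dB₁ y₀` (tree YOA) has three clauses: pair deviation `≤ sb₁` on the `Rg`-pairs of the reference, INTERFACE PIN `≤ dI₁` at
the sites within `Rg` of the exterior `X`, and a loose BULK PIN `≤ dB₁`.  RIM-PIN (desk finding «TUBE-UNIF-96», memo NODE-g96 §2c): a site joined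
to an interface-pinned site by a chain of `m` reference `Rg`-pairs deviates by at most `dI₁ + m·sb₁` — the bulk clause is never the active one
(`≤ 2/400` for every site of the `R ≤ 9.7` desk patches, `≤ 3–4/400` at the record `ρ = 16`, against `dB₁ ≤ 2/5`).  The same holds for the gauge set
`tubeGauge` (tree ZZZYO) in which the linear response (GRᴸ) is measured, so the bulk component `ΓB` of the response gauge is dominated by
`ΓI + m·Γb`: the certificate of (GRᴸ) (CERT-ARCH-26636-GR) owes NO bulk-site rows, and door W2o's side condition `ΓB < dB₁` becomes the
arithmetic `ΓI + m·Γb < dB₁`.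

* `IsRimReachable X Rg m y₀` — every site of the reference has a chain of `≤ m` `Rg`-pairs ending at a site within `Rg` of `X` (pure geometry of
  the reference; for the label reference it follows from the shadow-crystal geometry with `m ≈ ⌈diam(core)/Rg⌉` — typed as the Prop piece (RRᴸ)
  `LabelRimReachableP … m`, a ROUTINE geometric target, not proved here);
* `norm_le_of_mem_tubeGauge_chain`, `tubeGauge_subset_of_isRimReachable`, `bondTube_subset_of_isRimReachable` — RIM-PIN (PROVED);
* `labelGreenResponseP_of_rimReachable` — (RRᴸ)(m) ∧ (GRᴸ)(Γb, ΓI, ΓB) ⟹ (GRᴸ)(Γb, ΓI, min ΓB (ΓI + m·Γb)) (PROVED);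
* `mildCoherentMoatCorePG_W2p` — door W2o with the bulk response bound discharged: (GRᴸ) with ANY `ΓB ≥ 0` plus (RRᴸ)(m) and `ΓI + m·Γb < dB₁`.

Same namespace as the docket; 2 `def` (Prop pieces `IsRimReachable`, `LabelRimReachableP`) + 6 theorems + 1 example; 0 sorry; imports ZZZYO
only (linear chain ZZZYM → ZZZYN → ZZZYOA → ZZZYO → ZZZYPA). [g96]
-/

noncomputable section

open scoped BigOperators Classical
open MeasureTheory Set Metric Filter Topology
open Literature.MathematicalPhysics.StatisticalMechanics (lennardJones interactionEnergy)

namespace Summit.AtomisticToContinuum.Crystallization.Theorems.ChartedZeroExcessLayeredLatticeLiouville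

open Summit.AtomisticToContinuum.Crystallization.Theorems.ChartedPlanarOrderRigidityDoor (E3 IsClean)
open Summit.AtomisticToContinuum.Crystallization.Theorems.ChartedPlanarOrderDensityDichotomy (μS IsSep)
open Summit.AtomisticToContinuum.Crystallization.Theorems.ChartedPlanarOrderCleanScaleP (IsCleanP IsDoorSetP)
open Summit.AtomisticToContinuum.Crystallization.Theorems.ChartedPlanarOrderMesoCut (LayeredHom EnvClose)
open Summit.AtomisticToContinuum.Crystallization.Theorems.ChartedPlanarOrderDoorLayeredOsc (IsTwoShellAffineGood)

/-! ### ZZZYPA-1  Rim reachability and the RIM-PIN bound in the gauge set and in the tube (PROVED) -/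

section RimPin

variable {n : ℕ} {X : Set E3} {Rg : ℝ} {y₀ : Fin n → E3} {Γb ΓI ΓB sb dI dB : ℝ}

/-- **`IsRimReachable X Rg m y₀`**: every site `i` of the reference `y₀` is joined to an interface site (one within `Rg` of `X`) by a chain
`i = c 0, c 1, …, c m'` of at most `m` consecutive reference `Rg`-pairs.  Pure geometry of `(X, y₀)`. [this file, g96] -/
def IsRimReachable (X : Set E3) (Rg : ℝ) (m : ℕ) {n : ℕ} (y₀ : Fin n → E3) : Prop :=
  ∀ i : Fin n, ∃ m' : ℕ, m' ≤ m ∧ ∃ c : ℕ → Fin n, c 0 = i ∧ (∀ k < m', dist (y₀ (c k)) (y₀ (c (k + 1))) ≤ Rg) ∧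
    ∃ p ∈ X, dist (y₀ (c m')) p ≤ Rg

/-- one `Rg`-pair step in the gauge set: `‖c j‖ ≤ ρ'` and `dist (y₀ i) (y₀ j) ≤ Rg` give `‖c i‖ ≤ Γb + ρ'`. [this file, g96] -/
theorem norm_le_of_mem_tubeGauge_step {c : Fin n → E3} (hc : c ∈ tubeGauge X Rg Γb ΓI ΓB y₀) {i j : Fin n}
    (hij : dist (y₀ i) (y₀ j) ≤ Rg) {ρ' : ℝ} (hj : ‖c j‖ ≤ ρ') : ‖c i‖ ≤ Γb + ρ' := by
  have h1 := (mem_tubeGauge_iff.1 hc).1 i j hij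
  calc ‖c i‖ = ‖(c i - c j) + c j‖ := by rw [sub_add_cancel]
    _ ≤ ‖c i - c j‖ + ‖c j‖ := norm_add_le _ _
    _ ≤ Γb + ρ' := add_le_add h1 hj

/-- ★ **RIM-PIN in the gauge set**: along a chain of `m` reference `Rg`-pairs ending at an interface site, `‖c (c₀)‖ ≤ ΓI + m·Γb`. [this file, g96] -/
theorem norm_le_of_mem_tubeGauge_chain {c : Fin n → E3} (hc : c ∈ tubeGauge X Rg Γb ΓI ΓB y₀) :
    ∀ (m : ℕ) (ch : ℕ → Fin n), (∀ k < m, dist (y₀ (ch k)) (y₀ (ch (k + 1))) ≤ Rg) →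
      (∃ p ∈ X, dist (y₀ (ch m)) p ≤ Rg) → ‖c (ch 0)‖ ≤ ΓI + m * Γb := by
  intro m
  induction m with
  | zero =>
      intro ch _ hpin
      simpa using (mem_tubeGauge_iff.1 hc).2.1 (ch 0) hpin
  | succ m ih =>
      intro ch hch hpin
      have htail : ‖c (ch 1)‖ ≤ ΓI + m * Γb :=
        ih (fun k => ch (k + 1)) (fun k hk => hch (k + 1) (by omega)) (by simpa using hpin)
      have hstep := norm_le_of_mem_tubeGauge_step hc (hch 0 (by omega)) htail
      calc ‖c (ch 0)‖ ≤ Γb + (ΓI + m * Γb) := hstep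
        _ = ΓI + ((m + 1 : ℕ) : ℝ) * Γb := by push_cast; ring

/-- ★ **the bulk clause of the gauge set is dominated**: under rim reachability with `≤ m` steps (and `Γb ≥ 0`),
`tubeGauge(Γb, ΓI, ΓB) ⊆ tubeGauge(Γb, ΓI, min ΓB (ΓI + m·Γb))`. [this file, g96] -/
theorem tubeGauge_subset_of_isRimReachable {m : ℕ} (hR : IsRimReachable X Rg m y₀) (hb : 0 ≤ Γb) :
    tubeGauge X Rg Γb ΓI ΓB y₀ ⊆ tubeGauge X Rg Γb ΓI (min ΓB (ΓI + m * Γb)) y₀ := by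
  intro c hc
  obtain ⟨h1, h2, h3⟩ := mem_tubeGauge_iff.1 hc
  refine mem_tubeGauge_iff.2 ⟨h1, h2, fun i => le_min (h3 i) ?_⟩
  obtain ⟨m', hm', ch, hch0, hch, hpin⟩ := hR i
  have key := norm_le_of_mem_tubeGauge_chain hc m' ch hch hpin
  rw [hch0] at key
  have hmono : (m' : ℝ) * Γb ≤ m * Γb := mul_le_mul_of_nonneg_right (by exact_mod_cast hm') hb
  linarith

/-- ★ **RIM-PIN in the tube**: under rim reachability with `≤ m` steps (and `sb ≥ 0`), every member of `bondTube X Rg sb dI dB y₀` deviates by at most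
`dI + m·sb` at EVERY site: `bondTube(sb, dI, dB) ⊆ bondTube(sb, dI, min dB (dI + m·sb))`. [this file, g96] -/
theorem bondTube_subset_of_isRimReachable {m : ℕ} (hR : IsRimReachable X Rg m y₀) (hsb : 0 ≤ sb) :
    bondTube X Rg sb dI dB y₀ ⊆ bondTube X Rg sb dI (min dB (dI + m * sb)) y₀ := by
  intro z hz
  have hc : (fun i => z i - y₀ i) ∈ tubeGauge X Rg sb dI dB y₀ := by
    show (fun i => (z i - y₀ i) + y₀ i) ∈ bondTube X Rg sb dI dB y₀
    simpa using hz
  have hc' := tubeGauge_subset_of_isRimReachable (ΓI := dI) (ΓB := dB) hR hsb hc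
  have : (fun i => (z i - y₀ i) + y₀ i) ∈ bondTube X Rg sb dI (min dB (dI + m * sb)) y₀ := hc'
  simpa using this

end RimPin

/-! ### ZZZYPA-2  The Prop piece (RRᴸ) and the (GRᴸ) bulk discharge (PROVED) -/

section Pieces

/-- **(RRᴸ) «LabelRimReachableP … ϑ₀ Rg sb dI dB m …» — RIM REACHABILITY OF THE LABEL REFERENCE.**  Binders of (GRᴸ) VERBATIM up to the free
tube reference; conclusion: the label reference `lab ∘ xf` of the core, in the frozen field of `S ∖ core`, is rim-reachable in `≤ m` steps of
reference `Rg`-pairs.  Typed here so that the bulk clause of (GRᴸ) can be discharged by name.  ROUTINE for sites whose label is registered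
(`dist(·, x₀) > rΘ + q`): walk a lattice row of the placed crystal outward — covering (CV₂♮)@record (tree ZZZOA `bondLabelCoveringP₂_record`),
REG-in and injectivity make every row site within `ℓ` of `K` a label, the first non-core preimage is the rim witness, `m ≤ ⌈(ρ + q)/(17/20)⌉ + 1`.
NOT routine for HOT starts (`dist (xf i) k ≤ rΘ`): the binders locate a hot label only through the bond-graph embedding of `IsBondLabel`; the hot
half of the chain is exactly an `IsLabChain` of the W1 piece (LN₂♮) `BondLabelledNetP₂` (hot atom ↦ anchor atom), so the natural proof is
«(LN₂♮) ∧ binders ⟹ (RRᴸ)» — W1-coupled (memo NODE-g96 §4 (f)).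
Why it might fail: as typed (without (LN₂♮)) an «extra» hot label far from `K` with no reference partner and no exterior atom within `Rg` is not
visibly excluded by the binders (in substance it is, by core tameness and the free-tube-reference clause); with (LN₂♮) it is bookkeeping.
Sources: tree YOA (`bondTube`), tree ZZZYN ((GRᴸ)), tree ZZZOA ((CV₂♮), (LN₂♮)), memo NODE-g96 §2c, §4 (f). [this file, g96] -/
def LabelRimReachableP (ϑc ϑ ϑp r rΘ q rsh ρ rm σ ϑr Rs ε rI ℓ ϑ₀ Rg sb dI dB aHi Λ θ s : ℝ) (m : ℕ) : Prop :=
  ∀ δ : ℝ, 0 < δ → ∀ a : ℝ, 0 < a →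
    ∀ S : Set E3, IsDoorSetP aHi δ S → (∀ z : E3, Summable fun y : S => lennardJones (dist z (y : E3))) →
      (∀ p ∈ S, IsTwoShellAffineGood θ S p) →
        ∀ (L : E3 ≃L[ℝ] E3) (w : ℤ → E3), IsEquilChart a s Λ L w →
          ∀ (x₀ : E3) (K : Set E3), K ⊆ S → (∀ k ∈ K, dist k x₀ ≤ q) →
            IsTameOn ϑp S (LayeredHom (L : E3 →L[ℝ] E3) w) (coreOf S K rm) →
              IsTameOn ϑc S (LayeredHom (L : E3 →L[ℝ] E3) w) (moatIn S K r (r + rsh)) →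
                ∀ (n : ℕ) (xf : Fin n → E3), Function.Injective xf → Set.range xf = coreOf S K ρ →
                  ∀ (L' : E3 →L[ℝ] E3) (w' : ℤ → E3) (U : E3 ≃ₗᵢ[ℝ] E3) (t : E3),
                    IsCoolShadowCrystal σ ϑr Rs ε r rI ℓ S K (LayeredHom (L : E3 →L[ℝ] E3) w) L' w' U t →
                      ∀ lab : E3 → E3, IsBondLabel ε rΘ ℓ S K (placedCrystal L' w' U t) lab →
                        IsFreeTubeReference ϑ₀ ϑ Rg sb dI dB (S \ coreOf S K ρ) (LayeredHom (L : E3 →L[ℝ] E3) w) (fun i => lab (xf i)) →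
                          IsRimReachable (S \ coreOf S K ρ) Rg m (fun i => lab (xf i))

variable {ϑc ϑ ϑp r rΘ q rsh ρ rm σ ϑr Rs ε rI ℓ ϑ₀ Rg sb dI dB sb₁ dI₁ dB₁ Γb ΓI ΓB aHi Λ θ s : ℝ}

/-- ★ **(RRᴸ)(m) ∧ (GRᴸ)(Γb, ΓI, ΓB) ⟹ (GRᴸ)(Γb, ΓI, min ΓB (ΓI + m·Γb))** (`Γb ≥ 0`): the bulk component of the response gauge is dominated by the
interface component plus `m` pair steps — the certificate of (GRᴸ) owes no bulk-site rows. [this file, g96] -/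
theorem labelGreenResponseP_of_rimReachable {m : ℕ}
    (hRR : LabelRimReachableP ϑc ϑ ϑp r rΘ q rsh ρ rm σ ϑr Rs ε rI ℓ ϑ₀ Rg sb dI dB aHi Λ θ s m)
    (hGR : LabelGreenResponseP ϑc ϑ ϑp r rΘ q rsh ρ rm σ ϑr Rs ε rI ℓ ϑ₀ Rg sb dI dB sb₁ dI₁ dB₁ Γb ΓI ΓB aHi Λ θ s) (hb : 0 ≤ Γb) :
    LabelGreenResponseP ϑc ϑ ϑp r rΘ q rsh ρ rm σ ϑr Rs ε rI ℓ ϑ₀ Rg sb dI dB sb₁ dI₁ dB₁ Γb ΓI (min ΓB (ΓI + m * Γb)) aHi Λ θ s := by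
  intro δ hδ a ha S hS hsum hgood L w hchart x₀ K hK hKq htame₁ htame₂ n xf hxf hrange L' w' U t hcool lab hlab href φ₀ hφ₀ z hz
  obtain ⟨u, hu, hv⟩ := hGR δ hδ a ha S hS hsum hgood L w hchart x₀ K hK hKq htame₁ htame₂ n xf hxf hrange L' w' U t hcool lab hlab href φ₀ hφ₀ z hz
  have hR := hRR δ hδ a ha S hS hsum hgood L w hchart x₀ K hK hKq htame₁ htame₂ n xf hxf hrange L' w' U t hcool lab hlab href
  exact ⟨u, bondTube_subset_of_isRimReachable hR hb hu, hv⟩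

end Pieces

/-! ### ZZZYPA-3  Door W2p: W2o with the bulk response bound discharged by RIM-PIN (PROVED) -/

section Door

/-- ★★ **THE DOOR W2p**: as W2o, but (GRᴸ) may carry ANY bulk bound `ΓB ≥ 0` — the bulk side condition is replaced by rim reachability (RRᴸ)(m)
of the label reference and the arithmetic `ΓI + m·Γb < dB₁` (at the record: `dB₁ = 2/5`, `Γ• ≤ 1.5·10⁻³`, `m ≤ 8` ⟹ `0.0135 < 0.4`). [this file, g96] -/
theorem mildCoherentMoatCorePG_W2p {ϑc sb₁ dI₁ dB₁ sbp dIp dBp Γb ΓI ΓB lam c g₀ : ℝ} {m : ℕ}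
    (hϑc : ϑc ≤ 1 / 200000000000) (hlam : 0 < lam) (hc : 0 < c) (hg₀ : 0 < g₀)
    (hsb : 4 * sb₁ ≤ 249 / 5000) (hdI : 4 * dI₁ ≤ 249 / 5000) (hdB : dB₁ ≤ 2 / 5)
    (hΓb : 0 ≤ Γb) (hΓI : 0 ≤ ΓI) (hΓB : 0 ≤ ΓB) (hΓsb : Γb < sb₁) (hΓdI : ΓI < dI₁) (hm : ΓI + m * Γb < dB₁)
    (hX1 : LabelTubeConvexityP ϑc tameRadius (1 / 10) 8 (145 / 16) 4 12 16 16 (27 / 32) (1 / 10000) 5 (1 / 10000) 10 (43 / 2) (1 / 5000) (121 / 25)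
      (249 / 5000) (249 / 5000) (21 / 50) lam 1 2 (1 / 16) (1 / 50))
    (hREG : LabelRegularityP ϑc tameRadius (1 / 10) 8 (145 / 16) 4 12 16 16 (27 / 32) (1 / 10000) 5 (1 / 10000) 10 (43 / 2) (1 / 5000) (121 / 25)
      (249 / 5000) (249 / 5000) (21 / 50) sb₁ dI₁ dB₁ 1 2 (1 / 16) (1 / 50))
    (hRR : LabelRimReachableP ϑc tameRadius (1 / 10) 8 (145 / 16) 4 12 16 16 (27 / 32) (1 / 10000) 5 (1 / 10000) 10 (43 / 2) (1 / 5000) (121 / 25)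
      (249 / 5000) (249 / 5000) (21 / 50) 1 2 (1 / 16) (1 / 50) m)
    (hGR : LabelGreenResponseP ϑc tameRadius (1 / 10) 8 (145 / 16) 4 12 16 16 (27 / 32) (1 / 10000) 5 (1 / 10000) 10 (43 / 2) (1 / 5000) (121 / 25)
      (249 / 5000) (249 / 5000) (21 / 50) sb₁ dI₁ dB₁ Γb ΓI ΓB 1 2 (1 / 16) (1 / 50))
    (hKA : SoftCaptureP ϑc (1 / 10) 8 (145 / 16) 4 12 16 16 (27 / 32) (1 / 10000) 5 (1 / 10000) 10 (43 / 2) (121 / 25) sb₁ dI₁ dB₁ sbp dIp dBp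
      (121 / 25) (249 / 10000) 1 2 (1 / 16) (1 / 50))
    (hQS : SoftLedgerSharpP ϑc tameRadius (1 / 10) 8 (145 / 16) 4 12 16 16 (27 / 32) (1 / 10000) 5 (1 / 10000) 10 (43 / 2) (121 / 25) sb₁ dI₁ dB₁
      sbp dIp dBp (121 / 25) (249 / 10000) c 1 2 (1 / 16) (1 / 50))
    (hH : OffTubeHardGapMinP ϑc tameRadius (1 / 10) 8 (145 / 16) 4 12 16 16 (27 / 32) (1 / 10000) 5 (1 / 10000) 10 (43 / 2) (121 / 25) (249 / 5000)
      (249 / 5000) (21 / 50) sb₁ dI₁ dB₁ (121 / 25) (249 / 10000) g₀ 1 2 (1 / 16) (1 / 50)) :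
    MildCoherentMoatCorePG ϑc tameRadius (1 / 10) 8 4 12 16 1 2 (1 / 16) (1 / 50) :=
  have hB0 : 0 ≤ min ΓB (ΓI + m * Γb) := le_min hΓB (by positivity)
  have hBd : min ΓB (ΓI + m * Γb) < dB₁ := (min_le_right _ _).trans_lt hm
  mildCoherentMoatCorePG_W2o hϑc hlam hc hg₀ hsb hdI hdB hΓb hΓI hB0 hΓsb hΓdI hBd hX1 hREG
    (labelGreenResponseP_of_rimReachable hRR hGR hΓb) hKA hQS hH

/-- **DIAL EXAMPLE** (memo §2c: desk patches `R ≤ 9.7` are rim-reachable with `m = 1`, the record `ρ = 16` with `m ≤ 3`; E2/E3: `Γb ≤ 1.5·10⁻³`,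
`ΓI ≤ 8·10⁻⁴`): with `dB₁ = 2/5` the bulk side condition of W2p holds with room `× 75`. [this file, g96] -/
example : (1 / 1250 : ℝ) + (3 : ℕ) * (3 / 2000) < 2 / 5 ∧ (1 / 1250 : ℝ) + (8 : ℕ) * (3 / 2000) < 2 / 5 := by
  refine ⟨by norm_num, by norm_num⟩

end Door

end Summit.AtomisticToContinuum.Crystallization.Theorems.ChartedZeroExcessLayeredLatticeLiouville
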